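import Mathlib.Data.Real.Basic
import Mathlib.Order.MinMax
import Mathlib.Tactic

/-!
Copyright: pub-fluidc cell (idea-1 lens, gen 11). HONEST FRAMING: low prior, high value-of-information
experiment on Tao's machine paradigm; NOT a claim that NS blows up.

# KinkOptimum — the physical-currency ratio of a one-octave step as a kink function of band gain and spike ratio

Elementary real-arithmetic frame behind idea-1's K-R3E pre-registration (PREREG-R2.md §10ai, P-G11-2).
For an in-band start (`U_in(0) = ‖u(0)‖_∞`), band gain `g = U_out,pk / U_in(0)`, spike ratio
`Π = U_out,pk / ‖u(t_pk)‖_∞` and target factor `λ`, the cell's physical-currency ratio is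

  `r_phys = min(U_out, ‖u‖_∞)(t_pk) / (λ · U_in(0)) = (g/λ) · min(1, 1/Π)`.

The theorems below are the bookkeeping the ATLAS needs to read a certification in this currency:
* `rPhys_le_gain_div` — alignment cannot beat the band budget (`r_phys ≤ g/λ`, hence `r_phys⋆ ≤ g⋆/λ`);
* `rPhys_eq_of_pi_le_one` / `rPhys_eq_of_one_le_pi` — the two branches of the kink;
* `one_le_rPhys_iff` — THE DECIDING INEQUALITY: an amplitude event in physical currency (`1 ≤ r_phys`)
  holds iff `λ · max(1, Π) ≤ g`;
* `rPhys_eq_of_both_le_one` — flat below the kink: pushing `Π` below one buys nothing, so an optimum with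
  slack (`Π < 1`) and non-maximal gain is not converged (P-G11-2 (f)'s falsifier logic);
* `rPhys_lt_rPhys_iff_trade` — trading gain for alignment pays iff the new gain exceeds `g/Π`;
* two numeric instances with the deposited numbers of rows (a) and (e) (reading precision, not certification).
No PDE content; Mathlib only.

Provenance: statements and proofs by idea-1 gen 11 (`HOME/pub-fluidc-idea-1/lean/KinkOptimum.lean`, sha16
9e84bebc4819b429, LEAN ASK #8, cell STATUS l.4240); filed through the gate by pub-fluidc-lit gen 41 with the
imports moved above the header comment and one docstring added (`rPhys_def`); no statement was changed.
-/

namespace Summit.NavierStokesRegularity.FluidComputer.KinkOptimum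

/-- Physical-currency ratio of a one-octave step from band gain `g`, spike ratio `Pi` and target factor `lam`
(in-band start). -/
noncomputable def rPhys (lam g Pi : ℝ) : ℝ := g / lam * min 1 (1 / Pi)

/-- Unfolding lemma for `rPhys`. -/
theorem rPhys_def (lam g Pi : ℝ) : rPhys lam g Pi = g / lam * min 1 (1 / Pi) := rfl

/-- Band-binding branch of the kink: if the out-band sup does not exceed the full-field sup (`Π ≤ 1`),
`r_phys = g/λ`. -/
theorem rPhys_eq_of_pi_le_one {lam g Pi : ℝ} (hPi : 0 < Pi) (h : Pi ≤ 1) :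
    rPhys lam g Pi = g / lam := by
  have h1 : 1 ≤ 1 / Pi := by
    rw [le_div_iff₀ hPi]; simpa using h
  unfold rPhys
  rw [min_eq_left h1, mul_one]

/-- Full-field-binding branch: if `1 ≤ Π`, `r_phys = g/(λ Π)`. -/
theorem rPhys_eq_of_one_le_pi {lam g Pi : ℝ} (h : 1 ≤ Pi) :
    rPhys lam g Pi = g / (lam * Pi) := by
  have hPi : 0 < Pi := lt_of_lt_of_le one_pos h
  have h1 : 1 / Pi ≤ 1 := by
    rw [div_le_iff₀ hPi]; simpa using h
  unfold rPhys
  rw [min_eq_right h1, mul_one_div, div_div]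

/-- Alignment cannot beat the band budget: `r_phys ≤ g/λ`. -/
theorem rPhys_le_gain_div {lam g Pi : ℝ} (hlam : 0 < lam) (hg : 0 ≤ g) :
    rPhys lam g Pi ≤ g / lam := by
  have hgl : 0 ≤ g / lam := div_nonneg hg hlam.le
  have : min 1 (1 / Pi) ≤ 1 := min_le_left _ _
  calc rPhys lam g Pi = g / lam * min 1 (1 / Pi) := rfl
    _ ≤ g / lam * 1 := by exact mul_le_mul_of_nonneg_left this hgl
    _ = g / lam := by ring

/-- Hence a ceiling: any field whose band gain is at most `gstar` has `r_phys ≤ gstar/λ`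
(on the cell's manifold `gstar/λ = 3.21/2 = 1.60`). -/
theorem rPhys_le_of_gain_le {lam g gstar Pi : ℝ} (hlam : 0 < lam) (hg : 0 ≤ g) (hle : g ≤ gstar) :
    rPhys lam g Pi ≤ gstar / lam :=
  (rPhys_le_gain_div hlam hg).trans (div_le_div_of_nonneg_right hle hlam.le)

/-- THE DECIDING INEQUALITY. For positive `λ`, `Π`: an amplitude event in physical currency
(`1 ≤ r_phys`) holds iff `λ · max(1, Π) ≤ g`. -/
theorem one_le_rPhys_iff {lam g Pi : ℝ} (hlam : 0 < lam) (hPi : 0 < Pi) :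
    1 ≤ rPhys lam g Pi ↔ lam * max 1 Pi ≤ g := by
  rcases le_total Pi 1 with h | h
  · rw [rPhys_eq_of_pi_le_one hPi h, max_eq_left h, mul_one, le_div_iff₀ hlam, one_mul]
  · rw [rPhys_eq_of_one_le_pi h, max_eq_right h, le_div_iff₀ (mul_pos hlam hPi), one_mul]

/-- Negative form of the deciding inequality: no event iff `g < λ · max(1, Π)`. -/
theorem rPhys_lt_one_iff {lam g Pi : ℝ} (hlam : 0 < lam) (hPi : 0 < Pi) :
    rPhys lam g Pi < 1 ↔ g < lam * max 1 Pi := by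
  rw [← not_le, one_le_rPhys_iff hlam hPi, not_le]

/-- Flat below the kink: for `Π₁, Π₂ ≤ 1` the ratio does not depend on `Π`. Pushing the spike ratio below one
buys nothing; only gain does. -/
theorem rPhys_eq_of_both_le_one {lam g Pi₁ Pi₂ : ℝ} (h₁ : 0 < Pi₁) (h₁' : Pi₁ ≤ 1) (h₂ : 0 < Pi₂) (h₂' : Pi₂ ≤ 1) :
    rPhys lam g Pi₁ = rPhys lam g Pi₂ := by
  rw [rPhys_eq_of_pi_le_one h₁ h₁', rPhys_eq_of_pi_le_one h₂ h₂']

/-- Monotone in gain (both branches). -/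
theorem rPhys_mono_gain {lam g g' Pi : ℝ} (hlam : 0 < lam) (hPi : 0 < Pi) (hgg : g ≤ g') :
    rPhys lam g Pi ≤ rPhys lam g' Pi := by
  have hm : 0 ≤ min 1 (1 / Pi) := le_min zero_le_one (div_nonneg zero_le_one hPi.le)
  unfold rPhys
  exact mul_le_mul_of_nonneg_right (div_le_div_of_nonneg_right hgg hlam.le) hm

/-- Antitone in the spike ratio above the kink: for `1 ≤ Π₁ ≤ Π₂`, `r_phys(Π₂) ≤ r_phys(Π₁)`. -/
theorem rPhys_anti_pi {lam g Pi₁ Pi₂ : ℝ} (hlam : 0 < lam) (hg : 0 ≤ g) (h₁ : 1 ≤ Pi₁) (h₁₂ : Pi₁ ≤ Pi₂) :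
    rPhys lam g Pi₂ ≤ rPhys lam g Pi₁ := by
  have hP1 : 0 < Pi₁ := lt_of_lt_of_le one_pos h₁
  have hP2 : 0 < Pi₂ := lt_of_lt_of_le hP1 h₁₂
  rw [rPhys_eq_of_one_le_pi h₁, rPhys_eq_of_one_le_pi (h₁.trans h₁₂)]
  exact div_le_div_of_nonneg_left hg (mul_pos hlam hP1) (mul_le_mul_of_nonneg_left h₁₂ hlam.le)

/-- The trade criterion (row (a) → row (e)): from an interference optimum (`1 ≤ Π`) to an aligned field
(`Π' ≤ 1`) with smaller gain `g'`, the physical-currency ratio improves iff `g/Π < g'`. -/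
theorem rPhys_lt_rPhys_iff_trade {lam g g' Pi Pi' : ℝ} (hlam : 0 < lam) (hPi : 1 ≤ Pi)
    (hPi' : 0 < Pi') (hPi'1 : Pi' ≤ 1) :
    rPhys lam g Pi < rPhys lam g' Pi' ↔ g / Pi < g' := by
  have hP : 0 < Pi := lt_of_lt_of_le one_pos hPi
  rw [rPhys_eq_of_one_le_pi hPi, rPhys_eq_of_pi_le_one hPi' hPi'1,
    show g / (lam * Pi) = (g / Pi) / lam by rw [div_div, mul_comm]]
  exact div_lt_div_iff_of_pos_right hlam

/-! ### Numeric instances with the deposited numbers (reading precision; NOT a certification)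
Row (a) `R3A-96-band34-bsgain-p12-nu0.0025-T2` (dns-B N192 of record): `g = 3.2087`, `Π = 1.923`;
row (e) `R3E-96-band34-rphys-p12-nu0.0025-T2` (opt-adj j192435, 96³, T 2, unpeaked): `g = 2.2113`, `Π = 0.9829`. -/

/-- Row (a): the gain optimum is NOT an event in physical currency (`g < λ·Π`: 3.2087 < 2·1.923). -/
theorem rowA_not_event : rPhys 2 3.2087 1.923 < 1 := by
  rw [rPhys_lt_one_iff (by norm_num) (by norm_num)]
  norm_num [max_eq_right]

/-- Row (e): the aligned field IS an event at reading precision (`λ·max(1,Π) = 2 ≤ 2.2113`),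
pending the cell's certification K-R3E. -/
theorem rowE_event_at_reading_precision : 1 ≤ rPhys 2 2.2113 0.9829 := by
  rw [one_le_rPhys_iff (by norm_num) (by norm_num)]
  norm_num [max_eq_left]

/-- The trade paid: `g_a/Π_a = 3.2087/1.923 < 2.2113 = g_e`. -/
theorem rowA_to_rowE_trade_pays : rPhys 2 3.2087 1.923 < rPhys 2 2.2113 0.9829 := by
  rw [rPhys_lt_rPhys_iff_trade (by norm_num) (by norm_num) (by norm_num) (by norm_num)]
  norm_num

/-- Ceiling instance: with the manifold's gain optimum `g⋆ = 3.2087` every aligned-or-not field has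
`r_phys ≤ 1.60435`. -/
theorem manifold_ceiling {g Pi : ℝ} (hg : 0 ≤ g) (hle : g ≤ 3.2087) : rPhys 2 g Pi ≤ 1.60435 := by
  have := rPhys_le_of_gain_le (lam := 2) (Pi := Pi) (by norm_num) hg hle
  calc rPhys 2 g Pi ≤ 3.2087 / 2 := this
    _ = 1.60435 := by norm_num

end Summit.NavierStokesRegularity.FluidComputer.KinkOptimum
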